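import Mathlib.Data.Complex.Basic
import Summits.MatrixMultiplication.MatrixMultiplication.Theses.ReesMunnRealization
import Literature.Computability.AlgebraicComplexity.TensorRestrictionRank

/-!
# `RealizationRestricts` — a strict realization makes `⟨a,b,e⟩` a restriction of the host tensor

Route `MatrixMultiplication/ReesMunnRealization`, item `stmt-MatrixMultiplication-4373` (support):
Cohn–Umans 2013, Prop. 9 in strict form, for an arbitrary partial multiplication
`m : α → β → Option γ` with based tensor `t z x y = [m x y = some z]`.  If
`φ : [a]×[b] → α`, `ψ : [b]×[e] → β`, `χ : [a]×[e] → γ` satisfy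
`m (φ x) (ψ y) = some (χ z) ↔ (z.1 = x.1 ∧ x.2 = y.1 ∧ z.2 = y.2)`, then
`⟨a,b,e⟩ z x y = t (χ z) (φ x) (ψ y)` entrywise, so `⟨a,b,e⟩ = t ∘ (χ, φ, ψ)` is a restriction of `t`
along the three coordinate maps (`tensorRestrictsTo_precomp`; same proof as
`RealizesTPP.tensorRestrictsTo` in `GroupAlgebraTensor`).
-/

-- single-conjunct summit: the mandated namespace `Summit.MatrixMultiplication.MatrixMultiplication.…`
-- repeats `MatrixMultiplication` (summit = sub-problem), which `linter.dupNamespace` would flag.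
set_option linter.dupNamespace false

namespace Summit.MatrixMultiplication.MatrixMultiplication.Theorems

open Literature.Computability.AlgebraicComplexity

/-- **Strict realizations are restrictions** (settles `stmt-MatrixMultiplication-4373`, exact route
signature `Summit.MatrixMultiplication.MatrixMultiplication.Theses.ReesMunnRealization.RealizationRestricts`;
Cohn–Umans 2013, Prop. 9, strict `0/1` form): under the realization condition
`m (φ x) (ψ y) = some (χ z) ↔ (z.1 = x.1 ∧ x.2 = y.1 ∧ z.2 = y.2)` the matrix multiplication tensor
`⟨a,b,e⟩` coincides entrywise with `t ∘ (χ, φ, ψ)`, `t z x y = [m x y = some z]`, hence is a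
restriction of `t` (`tensorRestrictsTo_precomp`). [cite: CohnUmans2013, Prop. 9] -/
theorem RealizationRestricts_proof :
    Summit.MatrixMultiplication.MatrixMultiplication.Theses.ReesMunnRealization.RealizationRestricts := by
  unfold Summit.MatrixMultiplication.MatrixMultiplication.Theses.ReesMunnRealization.RealizationRestricts
  intro α β γ _ _ _ _ _ _ m a b e φ ψ χ hreal
  -- `⟨a,b,e⟩ = t ∘ (χ, φ, ψ)` entrywise
  have key : matMulTensor ℂ a b e = fun z x y =>
      (fun (z : γ) (x : α) (y : β) => if m x y = some z then (1 : ℂ) else 0) (χ z) (φ x) (ψ y) := by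
    funext z x y
    simp only [matMulTensor]
    exact (if_congr (hreal x y z) rfl rfl).symm
  rw [key]
  exact tensorRestrictsTo_precomp _ χ φ ψ

end Summit.MatrixMultiplication.MatrixMultiplication.Theorems
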